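import Summits.AtomisticToContinuum.Crystallization.Theses.ChessboardParticlePlanes
import Summits.AtomisticToContinuum.Crystallization.Theorems.ChessboardParticlePlanesLjPlaneChessboardLayerPlanar
import Literature.MathematicalPhysics.StatisticalMechanics.PeriodicConfigurationSums

/-!
# Crux `ChessboardParticlePlanes.LjPlaneChessboard` (stmt-AtomisticToContinuum-6709), line `Sketch`,
# auxiliary lemmas for stub `deficitSite_kernelForm` (summability and re-indexing)

General bookkeeping facts used to bring the per-site chessboard deficit into planar matrix-kernel
form (`ChessboardParticlePlanesLjPlaneChessboardDeficitKernel.lean`):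

* `deficitKernel_summable_points` — the Lennard-Jones site sum of a periodic configuration of `ℝ³`
  is summable over all its points (unpunctured form of `summable_lennardJones_dist_three`);
* `deficitKernel_prod_summable` (`_even`, `_odd`) — planar decay: for a full lattice `L` of the
  plane, `(v, i) ↦ V_LJ(√(‖X - v‖² + ζ_i²))` is summable on `L × ι` as soon as `|ζ_i| ≥ δ > 0`
  and `Σ_i ζ_i⁻² < ∞` (`R⁻⁶ ≤ (√(‖X - v‖² + δ²))⁻⁴ ζ_i⁻²`, `ZLattice.summable_norm_sub_inv_pow`
  with `4 > 2`, `summable_lennardJones_of_le`); in particular for `ζ_k = 2|k|d` (`k ≠ 0`) and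
  `ζ_k = |2k+1|d`, `d ≥ 3/4`;
* `deficitKernel_exch` — `Σ'_i Σ_{f ∈ G} Σ'_v = Σ_{f ∈ G} Σ'_v Σ'_i` for families summable on
  `L × ι` (`Summable.tsum_finsetSum`, `Summable.tsum_comm`);
* `deficitKernel_index_iff`, `deficitKernel_tsum_ne_int` — uniqueness of residue and quotient
  modulo `n`, and the re-indexing `Σ'_{m' ≠ i} g m' = Σ_{m<n} Σ'_j [m + jn ≠ i] g (m + jn)`
  (`tsum_subtype`, `Int.divModEquiv`, `Summable.tsum_prod`);
* `deficitKernel_presentation_shift` — a presentation `F` of the layers with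
  `F (m + n) = F m + g₀` satisfies `F (m + jn) = F m + j g₀` for all `j ∈ ℤ`;
* `deficitKernel_cross_summable` — for a layer presentation `F` (layer `m` is `F m + ℤa + ℤb`)
  and `x` of height `z i₀`, the cross-plane family
  `(v, j) ↦ V_LJ(√(‖πx - πf' - j πg₀ - v‖² + (z i₀ - z (m + jn))²))`, `f' ∈ F m`, is summable on
  `L × ℤ`: `(v, j) ↦ f' + j g₀ + k_v a + l_v b` injects into the points of `Q`, and the summand is
  `V_LJ(|x - ·|)` there (horizontal/vertical Pythagoras, `layerSumPlanar_norm_sq`).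

All [folklore]; no definition and no notation is introduced.
-/

noncomputable section

namespace Summit.AtomisticToContinuum.Crystallization.Theorems.ChessboardParticlePlanesLjPlaneChessboard

open Literature.MathematicalPhysics.StatisticalMechanics

/-- The Lennard-Jones site sum of a periodic configuration of `ℝ³` is summable over all points
(the punctured version `summable_lennardJones_dist_three` plus the at most one point `x`).
[folklore] -/
theorem deficitKernel_summable_points (P : PeriodicConfiguration 3) (x : EuclideanSpace ℝ (Fin 3)) :
    Summable fun y : {y // y ∈ P.points} => lennardJones (dist x y.1) := by
  have hfin : ({y : {y // y ∈ P.points} | y.1 = x} : Set _).Finite :=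
    Set.Subsingleton.finite fun y hy y' hy' => Subtype.ext (hy.trans hy'.symm)
  rw [← hfin.summable_compl_iff]
  let e : {y // y ∈ P.points ∧ y ≠ x} ≃
      (({y : {y // y ∈ P.points} | y.1 = x} : Set _)ᶜ : Set _) :=
    { toFun := fun y => ⟨⟨y.1, y.2.1⟩, y.2.2⟩
      invFun := fun y => ⟨y.1.1, y.1.2, y.2⟩
      left_inv := fun _ => rfl
      right_inv := fun _ => rfl }
  exact e.summable_iff.1 (P.summable_lennardJones_dist_three x)

/-- **Planar decay.**  For a full lattice `L` of the plane, `X ∈ ℝ²`, and vertical offsets `ζ i`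
with `|ζ i| ≥ δ > 0` and `Σ_i (ζ i)⁻² < ∞`, the family `(v, i) ↦ V_LJ(√(‖X - v‖² + (ζ i)²))` is
summable on `L × ι`: `R⁻⁶ ≤ (√(‖X - v‖² + δ²))⁻⁴ (ζ i)⁻²` and `Σ_v (√(‖X - v‖² + δ²))⁻⁴ < ∞`
(`ZLattice.summable_norm_sub_inv_pow`), then `summable_lennardJones_of_le`. [folklore] -/
theorem deficitKernel_prod_summable (L : Submodule ℤ (EuclideanSpace ℝ (Fin 2)))
    [DiscreteTopology L] [IsZLattice ℝ L] (X : EuclideanSpace ℝ (Fin 2)) {ι : Type*} {ζ : ι → ℝ}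
    {δ : ℝ} (hδ : 0 < δ) (hζ : ∀ i, δ ≤ |ζ i|) (hs : Summable fun i => (ζ i)⁻¹ ^ 2) :
    Summable fun p : L × ι =>
      lennardJones (Real.sqrt (‖X - (p.1 : EuclideanSpace ℝ (Fin 2))‖ ^ 2 + ζ p.2 ^ 2)) := by
  have hrk : Module.finrank ℤ L < 4 := by
    rw [ZLattice.rank ℝ L, finrank_euclideanSpace_fin]; norm_num
  -- the planar factor
  have hA : Summable fun v : L =>
      (Real.sqrt (‖X - (v : EuclideanSpace ℝ (Fin 2))‖ ^ 2 + δ ^ 2))⁻¹ ^ 4 := by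
    refine Summable.of_norm_bounded_eventually (ZLattice.summable_norm_sub_inv_pow L 4 hrk X) ?_
    have hfin : ({v : L | (v : EuclideanSpace ℝ (Fin 2)) = X} : Set L).Finite :=
      Set.Subsingleton.finite fun v hv w hw => Subtype.ext (hv.trans hw.symm)
    refine Filter.eventually_cofinite.2 (hfin.subset fun v hv => ?_)
    by_contra hne
    apply hv
    have hpos : 0 < ‖(v : EuclideanSpace ℝ (Fin 2)) - X‖ := norm_pos_iff.2 (sub_ne_zero.2 hne)
    rw [Real.norm_of_nonneg (by positivity)]
    refine pow_le_pow_left₀ (by positivity) (inv_anti₀ hpos ?_) 4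
    rw [norm_sub_rev]
    exact Real.le_sqrt_of_sq_le (by nlinarith)
  have hζ2 : ∀ i, δ ^ 2 ≤ ζ i ^ 2 := fun i => by
    rw [← sq_abs (ζ i)]; exact pow_le_pow_left₀ hδ.le (hζ i) 2
  have hR : ∀ p : L × ι, δ ≤ Real.sqrt (‖X - (p.1 : EuclideanSpace ℝ (Fin 2))‖ ^ 2 + ζ p.2 ^ 2) :=
    fun p => Real.le_sqrt_of_sq_le
      (by nlinarith [sq_nonneg ‖X - (p.1 : EuclideanSpace ℝ (Fin 2))‖, hζ2 p.2])
  have key : ∀ p : L × ι,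
      (Real.sqrt (‖X - (p.1 : EuclideanSpace ℝ (Fin 2))‖ ^ 2 + ζ p.2 ^ 2))⁻¹ ^ 6 ≤
      (Real.sqrt (‖X - (p.1 : EuclideanSpace ℝ (Fin 2))‖ ^ 2 + δ ^ 2))⁻¹ ^ 4 * (ζ p.2)⁻¹ ^ 2 := by
    rintro ⟨v, i⟩
    have hS : 0 < Real.sqrt (‖X - (v : EuclideanSpace ℝ (Fin 2))‖ ^ 2 + δ ^ 2) :=
      Real.sqrt_pos.2 (by positivity)
    have hSR : Real.sqrt (‖X - (v : EuclideanSpace ℝ (Fin 2))‖ ^ 2 + δ ^ 2) ≤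
        Real.sqrt (‖X - (v : EuclideanSpace ℝ (Fin 2))‖ ^ 2 + ζ i ^ 2) :=
      Real.sqrt_le_sqrt (by linarith [hζ2 i])
    have hζR : |ζ i| ≤ Real.sqrt (‖X - (v : EuclideanSpace ℝ (Fin 2))‖ ^ 2 + ζ i ^ 2) :=
      Real.le_sqrt_of_sq_le
        (by rw [sq_abs]; nlinarith [sq_nonneg ‖X - (v : EuclideanSpace ℝ (Fin 2))‖])
    have h1 := pow_le_pow_left₀ (inv_nonneg.2 (Real.sqrt_nonneg _)) (inv_anti₀ hS hSR) 4
    have h2 := pow_le_pow_left₀ (inv_nonneg.2 (Real.sqrt_nonneg _))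
      (inv_anti₀ (hδ.trans_le (hζ i)) hζR) 2
    calc (Real.sqrt (‖X - (v : EuclideanSpace ℝ (Fin 2))‖ ^ 2 + ζ i ^ 2))⁻¹ ^ 6
        = (Real.sqrt (‖X - (v : EuclideanSpace ℝ (Fin 2))‖ ^ 2 + ζ i ^ 2))⁻¹ ^ 4 *
            (Real.sqrt (‖X - (v : EuclideanSpace ℝ (Fin 2))‖ ^ 2 + ζ i ^ 2))⁻¹ ^ 2 := by ring
      _ ≤ (Real.sqrt (‖X - (v : EuclideanSpace ℝ (Fin 2))‖ ^ 2 + δ ^ 2))⁻¹ ^ 4 * (|ζ i|)⁻¹ ^ 2 :=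
          mul_le_mul h1 h2 (by positivity) (by positivity)
      _ = _ := by rw [inv_pow, inv_pow, inv_pow, sq_abs]
  have hR6 : Summable fun p : L × ι =>
      (Real.sqrt (‖X - (p.1 : EuclideanSpace ℝ (Fin 2))‖ ^ 2 + ζ p.2 ^ 2))⁻¹ ^ 6 :=
    Summable.of_nonneg_of_le (fun p => by positivity) key
      (hA.mul_of_nonneg hs (fun v => by positivity) fun i => by positivity)
  exact summable_lennardJones_of_le hδ hR hR6

/-- Planar decay for the self-copy offsets `ζ_k = 2|k|d`, `k ≠ 0`, `d ≥ 3/4`: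
`(v, k) ↦ V_LJ(√(‖X - v‖² + (2|k|d)²))` is summable on `L × {k ≠ 0}`. [folklore] -/
theorem deficitKernel_prod_summable_even (L : Submodule ℤ (EuclideanSpace ℝ (Fin 2)))
    [DiscreteTopology L] [IsZLattice ℝ L] (X : EuclideanSpace ℝ (Fin 2)) {d : ℝ}
    (hd : (3 : ℝ) / 4 ≤ d) :
    Summable fun p : L × {k : ℤ // k ≠ 0} => lennardJones (Real.sqrt
      (‖X - (p.1 : EuclideanSpace ℝ (Fin 2))‖ ^ 2 + (2 * |(p.2 : ℝ)| * d) ^ 2)) := by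
  have h1 : Summable fun k : ℤ => 1 / (k : ℝ) ^ 2 := Real.summable_one_div_int_pow.2 one_lt_two
  refine deficitKernel_prod_summable L X (ζ := fun k : {k : ℤ // k ≠ 0} => 2 * |(k : ℝ)| * d)
    (by linarith : 0 < d) (fun k => ?_) ?_
  · have hk : (1 : ℝ) ≤ |(k : ℝ)| := by exact_mod_cast Int.one_le_abs k.2
    rw [abs_of_nonneg (by positivity)]
    nlinarith
  · refine ((h1.subtype _).mul_left ((2 * d)⁻¹ ^ 2)).congr fun k => ?_
    simp only [Function.comp_apply, inv_pow, mul_pow, sq_abs, one_div]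
    ring

/-- Planar decay for the partner offsets `ζ_k = |2k+1|d`, `d ≥ 3/4`:
`(v, k) ↦ V_LJ(√(‖X - v‖² + (|2k+1|d)²))` is summable on `L × ℤ`. [folklore] -/
theorem deficitKernel_prod_summable_odd :
    ∀ (L : Submodule ℤ (EuclideanSpace ℝ (Fin 2))) [DiscreteTopology L] [IsZLattice ℝ L]
      (X : EuclideanSpace ℝ (Fin 2)) (d : ℝ), (3 : ℝ) / 4 ≤ d →
      Summable (fun p : L × ℤ => lennardJones (Real.sqrt
        (‖X - (p.1 : EuclideanSpace ℝ (Fin 2))‖ ^ 2 + (|2 * (p.2 : ℝ) + 1| * d) ^ 2))) := by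
  intro L _ _ X d hd
  have h1 : Summable fun k : ℤ => 1 / (k : ℝ) ^ 2 := Real.summable_one_div_int_pow.2 one_lt_two
  refine deficitKernel_prod_summable L X (ζ := fun k : ℤ => |2 * (k : ℝ) + 1| * d)
    (by linarith : 0 < d) (fun k => ?_) ?_
  · have hk : (1 : ℝ) ≤ |2 * (k : ℝ) + 1| := by
      exact_mod_cast (Int.one_le_abs (by omega) : (1 : ℤ) ≤ |2 * k + 1|)
    rw [abs_of_nonneg (by positivity)]
    nlinarith
  · have h2 := (h1.comp_injective (fun k k' (h : 2 * k + 1 = 2 * k' + 1) => by omega :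
        Function.Injective fun k : ℤ => 2 * k + 1)).mul_left (d⁻¹ ^ 2)
    refine h2.congr fun k => ?_
    simp only [Function.comp_apply, inv_pow, mul_pow, sq_abs, one_div, mul_inv]
    push_cast
    ring

/-- Exchange `Σ'_i Σ_{f ∈ G} Σ'_v = Σ_{f ∈ G} Σ'_v Σ'_i` for families summable on `L × ι`
(`Summable.tsum_finsetSum`, `Summable.tsum_comm`). [folklore] -/
theorem deficitKernel_exch {ι γ : Type*} {L : Submodule ℤ (EuclideanSpace ℝ (Fin 2))}
    (G : Finset γ) (Φ : γ → L → ι → ℝ) (h : ∀ f ∈ G, Summable (Function.uncurry (Φ f))) :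
    ∑' i, ∑ f ∈ G, ∑' v, Φ f v i = ∑ f ∈ G, ∑' v, ∑' i, Φ f v i := by
  rw [Summable.tsum_finsetSum (f := fun f i => ∑' v, Φ f v i)
    (fun f hf => (h f hf).prod_symm.prod)]
  exact Finset.sum_congr rfl fun f hf => (h f hf).tsum_comm

/-- Uniqueness of residue and quotient: for `0 ≤ m < n` and `0 ≤ M < n`,
`m + jn = M + Jn ↔ m = M ∧ j = J`. [folklore] -/
theorem deficitKernel_index_iff {n m : ℕ} (hm : m < n) {M : ℤ} (hM0 : 0 ≤ M) (hMn : M < n)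
    (j J : ℤ) : (m : ℤ) + j * n = M + J * n ↔ (m : ℤ) = M ∧ j = J := by
  have hn' : (n : ℤ) ≠ 0 := by exact_mod_cast (Nat.pos_of_ne_zero (by omega) : 0 < n).ne'
  have hm0 : (0 : ℤ) ≤ m := Int.natCast_nonneg m
  have hmn : (m : ℤ) < n := by exact_mod_cast hm
  constructor
  · intro h
    have h1 := congrArg (· % (n : ℤ)) h
    simp only [Int.add_mul_emod_self_right, Int.emod_eq_of_lt hm0 hmn,
      Int.emod_eq_of_lt hM0 hMn] at h1
    refine ⟨h1, ?_⟩
    rw [h1] at h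
    exact mul_right_cancel₀ hn' (add_left_cancel h)
  · rintro ⟨h1, rfl⟩
    rw [h1]

/-- Re-indexing a sum over the planes `m' ≠ i` by residue and quotient modulo `n`:
`Σ'_{m' ≠ i} g m' = Σ_{m < n} Σ'_j [m + jn ≠ i] g (m + jn)` for a summable family
(`tsum_subtype`, `Int.divModEquiv`, `Summable.tsum_prod`). [folklore] -/
theorem deficitKernel_tsum_ne_int {g : ℤ → ℝ} {n : ℕ} (hn : 0 < n) (i : ℤ)
    (hg : Summable fun m : {m : ℤ // m ≠ i} => g m) :
    ∑' m : {m : ℤ // m ≠ i}, g m =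
      ∑ m ∈ Finset.range n, ∑' j : ℤ, (if (m : ℤ) + j * n = i then 0 else g (m + j * n)) := by
  haveI : NeZero n := ⟨hn.ne'⟩
  set g' : ℤ → ℝ := fun m => if m = i then 0 else g m with hg'
  have hind : ({i}ᶜ : Set ℤ).indicator g = g' := by
    funext m
    simp only [hg', Set.indicator_apply, Set.mem_compl_iff, Set.mem_singleton_iff]
    split_ifs <;> simp_all
  have hs : Summable g' :=
    hind ▸ (summable_subtype_iff_indicator (s := ({i}ᶜ : Set ℤ)) (f := g)).1 hg
  let e : Fin n × ℤ ≃ ℤ := (Equiv.prodComm _ _).trans (Int.divModEquiv n).symm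
  calc ∑' m : {m : ℤ // m ≠ i}, g m = ∑' m, g' m := by rw [← hind]; exact tsum_subtype _ g
    _ = ∑' p : Fin n × ℤ, g' (e p) := (e.tsum_eq g').symm
    _ = ∑' (m : Fin n) (j : ℤ), g' (e (m, j)) := (e.summable_iff.2 hs).tsum_prod
    _ = ∑ m : Fin n, ∑' j : ℤ, g' ((m : ℕ) + j * n) := by
        rw [tsum_fintype]
        refine Finset.sum_congr rfl fun m _ => tsum_congr fun j => ?_
        simp [e, add_comm]
    _ = _ := Fin.sum_univ_eq_sum_range (fun m => ∑' j : ℤ, g' ((m : ℤ) + j * n)) n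

/-- A vertically periodic presentation, `F (m + n) = F m + g₀`, satisfies `F (m + jn) = F m + j g₀`
for every `j ∈ ℤ` (induction on `j`; translations are injective). [folklore] -/
theorem deficitKernel_presentation_shift (F : ℤ → Finset (EuclideanSpace ℝ (Fin 3)))
    (g₀ : EuclideanSpace ℝ (Fin 3)) (n : ℕ)
    (hFper : ∀ m : ℤ, F (m + n) = (F m).image (fun f => f + g₀)) (j m : ℤ) :
    F (m + j * n) = (F m).image (fun f => f + (j : ℝ) • g₀) := by
  induction j with
  | zero => simp
  | succ i ih =>
      rw [show m + ((i : ℤ) + 1) * n = (m + i * n) + n by ring, hFper, ih, Finset.image_image]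
      congr 1
      funext f
      simp only [Function.comp_apply, Int.cast_add, Int.cast_one, add_smul, one_smul, add_assoc]
  | pred i ih =>
      have h := hFper (m + (-(i : ℤ) - 1) * n)
      rw [show m + (-(i : ℤ) - 1) * n + n = m + -(i : ℤ) * n by ring, ih] at h
      have h2 := congrArg (Finset.image fun f => f - g₀) h
      simp only [Finset.image_image, Function.comp_def, add_sub_cancel_right, Finset.image_id']
        at h2
      rw [← h2]
      congr 1
      funext f
      rw [Int.cast_sub, Int.cast_one, sub_smul, one_smul, add_sub_assoc]

/-- **Summability of the cross-plane families.**  For a layer presentation `F` of `Q` (layer `m`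
is `F m + ℤa + ℤb`, stable under `f ↦ f + j g₀`, `m ↦ m + jn`), horizontal `ℝ`-independent `a, b`
with planar lattice `L = ℤ πa + ℤ πb`, a strictly increasing `z` and `x` of height `z i₀`: for
`f' ∈ F m` the family `(v, j) ↦ V_LJ(√(‖πx - πf' - j πg₀ - v‖² + (z i₀ - z (m + jn))²))` is
summable on `L × ℤ`, being `V_LJ(|x - y|)` along the injection
`(v, j) ↦ y = f' + j g₀ + k_v a + l_v b` into the points of `Q` (`deficitKernel_summable_points`,
`layerSumPlanar_norm_sq`). [folklore] -/
theorem deficitKernel_cross_summable (Q : PeriodicConfiguration 3)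
    (a b g₀ x : EuclideanSpace ℝ (Fin 3)) (z : ℤ → ℝ) (n : ℕ)
    (F : ℤ → Finset (EuclideanSpace ℝ (Fin 3))) (L : Submodule ℤ (EuclideanSpace ℝ (Fin 2)))
    (i₀ : ℤ) (ha2 : a 2 = 0) (hb2 : b 2 = 0) (hab : LinearIndependent ℝ ![a, b])
    (hL : ∀ v : EuclideanSpace ℝ (Fin 2),
      v ∈ L ↔ ∃ k l : ℤ, v = (k : ℝ) • !₂[a 0, a 1] + (l : ℝ) • !₂[b 0, b 1])
    (hn : 0 < n) (hz : StrictMono z) (hxz : x 2 = z i₀)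
    (hFmem : ∀ m : ℤ, ∀ f ∈ F m, f 2 = z m ∧ f ∈ Q.points)
    (hFlayer : ∀ (m : ℤ) (y : EuclideanSpace ℝ (Fin 3)),
      (y ∈ Q.points ∧ y 2 = z m) ↔ ∃ f ∈ F m, ∃ k l : ℤ, y = f + (k : ℝ) • a + (l : ℝ) • b)
    (hFsh : ∀ (j m : ℤ) (f : EuclideanSpace ℝ (Fin 3)), f ∈ F m →
      f + (j : ℝ) • g₀ ∈ F (m + j * n))
    {m : ℤ} {f' : EuclideanSpace ℝ (Fin 3)} (hf' : f' ∈ F m) :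
    Summable fun p : L × ℤ => lennardJones (Real.sqrt
      (‖!₂[x 0, x 1] - !₂[f' 0, f' 1] - (p.2 : ℝ) • !₂[g₀ 0, g₀ 1]
          - (p.1 : EuclideanSpace ℝ (Fin 2))‖ ^ 2 + (z i₀ - z (m + p.2 * n)) ^ 2)) := by
  have hn' : (n : ℤ) ≠ 0 := by exact_mod_cast hn.ne'
  -- integer coordinates on `L`, and additivity of the projection
  have hLrep : ∀ v : L, ∃ kl : ℤ × ℤ,
      (v : EuclideanSpace ℝ (Fin 2)) = (kl.1 : ℝ) • !₂[a 0, a 1] + (kl.2 : ℝ) • !₂[b 0, b 1] :=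
    fun v => by obtain ⟨k, l, h⟩ := (hL v).1 v.2; exact ⟨(k, l), h⟩
  choose kl hkl using hLrep
  have hkl_inj : Function.Injective kl := fun v w h => Subtype.ext (by rw [hkl v, hkl w, h])
  have hπadd : ∀ (f : EuclideanSpace ℝ (Fin 3)) (t : ℝ),
      (!₂[(f + t • g₀) 0, (f + t • g₀) 1] : EuclideanSpace ℝ (Fin 2)) =
        !₂[f 0, f 1] + t • !₂[g₀ 0, g₀ 1] := by
    intro f t
    ext i
    fin_cases i <;> simp
  -- the points `y = f' + j g₀ + k_v a + l_v b` of `Q`, of height `z (m + jn)`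
  have hmem : ∀ p : L × ℤ,
      f' + (p.2 : ℝ) • g₀ + ((kl p.1).1 : ℝ) • a + ((kl p.1).2 : ℝ) • b ∈ Q.points ∧
      (f' + (p.2 : ℝ) • g₀ + ((kl p.1).1 : ℝ) • a + ((kl p.1).2 : ℝ) • b) 2 = z (m + p.2 * n) :=
    fun p => (hFlayer (m + p.2 * n) _).2
      ⟨f' + (p.2 : ℝ) • g₀, hFsh p.2 m f' hf', (kl p.1).1, (kl p.1).2, rfl⟩
  let Ψ : L × ℤ → {y // y ∈ Q.points} := fun p => ⟨_, (hmem p).1⟩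
  have hΨ : Function.Injective Ψ := by
    rintro ⟨v, j⟩ ⟨v', j'⟩ h
    have h' : f' + (j : ℝ) • g₀ + ((kl v).1 : ℝ) • a + ((kl v).2 : ℝ) • b =
        f' + (j' : ℝ) • g₀ + ((kl v').1 : ℝ) • a + ((kl v').2 : ℝ) • b := congrArg Subtype.val h
    have hj : j = j' := by
      have h2 : z (m + j * n) = z (m + j' * n) := by
        rw [← (hmem (v, j)).2, ← (hmem (v', j')).2, h']
      exact mul_right_cancel₀ hn' (add_left_cancel (hz.injective h2))
    subst hj
    have hkl' : kl v = kl v' := layerSumPlanar_comb_injective hab (f' + (j : ℝ) • g₀) h'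
    exact Prod.ext (hkl_inj hkl') rfl
  refine ((deficitKernel_summable_points Q x).comp_injective hΨ).congr ?_
  rintro ⟨v, j⟩
  -- the summand: horizontal/vertical Pythagoras
  have e := layerSumPlanar_norm_sq ha2 hb2 (hFmem _ _ (hFsh j m f' hf')).1 x (kl v).1 (kl v).2
  rw [← hkl v, hπadd, ← sub_sub (!₂[x 0, x 1]) (!₂[f' 0, f' 1]) ((j : ℝ) • !₂[g₀ 0, g₀ 1]), hxz]
    at e
  simp only [Function.comp_apply, Ψ, dist_eq_norm]
  rw [show ‖!₂[x 0, x 1] - !₂[f' 0, f' 1] - (j : ℝ) • !₂[g₀ 0, g₀ 1]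
        - (v : EuclideanSpace ℝ (Fin 2))‖ ^ 2 + (z i₀ - z (m + j * n)) ^ 2 =
      ‖x - (f' + (j : ℝ) • g₀ + ((kl v).1 : ℝ) • a + ((kl v).2 : ℝ) • b)‖ ^ 2 by rw [← e]; ring,
    Real.sqrt_sq (norm_nonneg _)]

end Summit.AtomisticToContinuum.Crystallization.Theorems.ChessboardParticlePlanesLjPlaneChessboard

end
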